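import Summits.HubbardSuperconductivity.HubbardSuperconductivity.Theses.JosephsonMirror
import Summits.HubbardSuperconductivity.HubbardSuperconductivity.Theorems.JosephsonMirrorJmPairBridgeGenericCoupling
import Summits.HubbardSuperconductivity.HubbardSuperconductivity.Theorems.JosephsonMirrorJmPairBridgeSchurCusp
import Summits.HubbardSuperconductivity.HubbardSuperconductivity.Theorems.BalabanIRBirEveryGroundStatePencil
import HarnessLib

/-!
# Crux `JmPairBridge` (stmt-HubbardSuperconductivity-2226) — line `schur-rigid-bridge`, LEAD SKELETON (c4 lead; inherited final form of leads c2/c3)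

Route `JosephsonMirror`, crux `JmPairBridge` = thesis X: the EVERY-ground-state Penrose–Onsager pair bridge
`|⟨χ, Δ_d φ⟩|² ≥ a L⁴` between the `(N_L, S^z = 0)` and `(N_L − 2, S^z = 0)` ground floors of
`hubbardTorus 2 L 1 U` (`N_L = 2⌊(1-δ)L²/2⌋`, `Δ_d = pairField dWaveFormFactor L`).

THE LINE (card `Cruxes/JmPairBridge/Ideas/schur-rigid-bridge.md`; planner skeleton
`line-schur-rigid-bridge.lean`, stubs `stub_someBridgeWindow`, `stub_reducibleFloorPropagates`,
`stub_irreducibleFloorDense`; rebuilt by the c2 lead from the registered stub list and the card — the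
planner's file lives in the gate evidence store, which is not mounted in the lead's jail).

* Schur rigidity (LANDED, line `Sketch`: `everyFromSome_torus`,
  `exists_symmetryFamily_of_spaceGroup_irreducible`): ONE bridged unit ground pair + SPACE-GROUP
  IRREDUCIBILITY of the `(N, 0)` floor ⇒ every unit ground state is bridged with the same constant.
* The coupling is SELECTED, not posited: the some-pair bridge is assumed on an open `U`-window
  (`stub_someBridgeWindow`, the window form of `JmInterchange ∘ JmCusp (i)` — the residue, crux-sized), and
  inside the window a coupling `U⋆` is chosen that is simultaneously NON-EXCEPTIONAL for every torus side
  (maximal number of distinct eigenvalues of `hubbardTorus 2 L 1 U⋆`; tree: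
  `exists_coupling_forall_card_roots_le_hubbardTorus`, Hermite–Sylvester/Hankel).
* At a non-exceptional coupling the floor cannot be ACCIDENTALLY reducible: reducibility of the floor is an
  OPEN condition near a non-exceptional coupling (`reducibleFloorPropagates`, PROVED here from four
  finite-dimensional stubs: the gap above a degenerate floor `stub_floorGap`, no splitting of eigenvalues
  near a generic point of a continuous Hermitian family `stub_noSplitNearGeneric` (tree:
  `Literature.LinearAlgebra.Matrix.HermitianFamilyBranches`), stability of the floor dimension and of its
  position `stub_floorUpper` / `stub_floorLower` (variational perturbation theory in the invariant sector),
  and the equivariant transport of irreducibility through an injective compression `stub_floorTransport`),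
  so density of irreducible couplings (`stub_irreducibleFloorDense`, the spectral residue replacing
  `JmCusp (ii)`: "for every large even side, space-group-irreducible floors are dense in `U > 0`") forces
  irreducibility at `U⋆` for every large even `L` (`irreducible_of_generic`).
* Composition `JmPairBridge_of`: X with `(U⋆, δ, a(U⋆), max L₀ L₁)`.

Stubs (self-contained signatures, tree vocabulary, no definitions):
1. `stub_someBridgeWindow` — RESIDUE (crux-sized; = window form of stmt-2227 ∘ stmt-2228 (i)). OPEN.
2. `stub_irreducibleFloorDense` — RESIDUE (spectral: no systematic all-`U` reducibility of the `(N_L,0)`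
   floor for large even `L`; false at `L = 4` (hypercube symmetry), hence `L₁`). OPEN.
3. `stub_floorGap` — abstract: strict gap above a (possibly degenerate) floor in an invariant subspace,
   attained when the orthocomplement is non-trivial. PROVABLE (cf. `exists_gap_of_unique`).
4. `stub_noSplitNearGeneric` — abstract: near a coupling with the maximal number of distinct eigenvalues a
   continuous Hermitian family has at most one eigenvalue near each eigenvalue. PROVABLE
   (`exists_isOpen_labelled`, `labelling_of_close`).
5. `stub_floorUpper` — abstract pencil: near `U₀` the floor of `u` injects into the floor of `U₀` under the
   orthogonal compression (gap at `U₀` + Lipschitz forms). PROVABLE.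
6. `stub_floorLower` — abstract pencil: near a no-split coupling the floor dimension does not drop. PROVABLE.
7. `stub_floorTransport` — abstract: irreducibility passes through an injective equivariant compression
   between floors of equal dimension. PROVABLE.

Sources: T. Kato, *Perturbation Theory for Linear Operators* (1966), Ch. II §§1.1, 5.1–6.2 (finitely many
exceptional points; continuity of eigenvalues and eigenprojections of symmetric families); J.-P. Serre,
*Linear Representations of Finite Groups* §2.2 (Schur); H. Tasaki, *Physics and Mathematics of Quantum
Many-Body Systems* (2020) §2.1; T. Koma, H. Tasaki, J. Stat. Phys. 76 (1994) 745, §3.4.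
-/

noncomputable section

-- the mandated namespace `Summit.<Summit>.<Problem>.Theorems` repeats `HubbardSuperconductivity`
-- (single-problem summit, D-0017), which the `dupNamespace` linter flags on every declaration
set_option linter.dupNamespace false

namespace Summit.HubbardSuperconductivity.HubbardSuperconductivity.Theorems.JosephsonMirror

open Matrix Literature.MathematicalPhysics.QuantumLattice Literature.Probability.LatticeModels
open Summit.HubbardSuperconductivity.HubbardSuperconductivity.Theses.JosephsonMirror (JmPairBridge)
open scoped ComplexOrder

/-! ## Stubs 3–7 (finite-dimensional spectral perturbation theory) and the compositions are LANDED: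
`stub_floorGap` p120999, `stub_noSplitNearGeneric` p121056, `stub_floorUpper` p121195, `stub_floorLower` p121099,
`stub_floorTransport` p121079, and `irreducibilityLocallyConstant` / `reducibleFloorPropagates` /
`irreducible_of_generic_of_dense[On]` / `jmPairBridge_of_someBridgeWindow_of_dense[On]`
(`Theorems/JosephsonMirrorJmPairBridgeGenericCoupling.lean`, `…WindowResidue.lean`, imported). -/

/-! ## Stubs 1–2: the residue (OPEN inputs of the line) -/

/-- **STUB `stub_someBridgeWindow`** (THE RESIDUE, crux-sized — the window form of the mirror's output
`JmInterchange ∘ JmCusp (i)`, stmt-2227/2228): some `δ ∈ (0, 1/2)` and an open window of repulsive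
couplings `(U₁, U₂)`, `0 < U₁`, such that at EVERY `U` in the window, eventually in even `L`, SOME unit
ground-floor pair `φ₀ ∈ (N_L, 0)`, `χ₀ ∈ (N_L - 2, 0)` is bridged: `a L⁴ ≤ |⟨χ₀, Δ_d φ₀⟩|²`.
Not claimed provable now. Koma–Tasaki (1994) §3.4. -/
theorem stub_someBridgeWindow :
    ∃ δ ∈ Set.Ioo (0:ℝ) (1 / 2), ∃ U₁ U₂ : ℝ, 0 < U₁ ∧ U₁ < U₂ ∧ ∀ U ∈ Set.Ioo U₁ U₂,
      ∃ a : ℝ, 0 < a ∧ ∃ L₀ : ℕ, ∀ (L : ℕ) [NeZero L], Even L → L₀ ≤ L →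
        ∃ φ₀ χ₀ : Fock (Orb (FermionTorus 2 L)),
          IsGroundStateInSector (hubbardTorus 2 L 1 U) (2 * ⌊(1 - δ) * (L : ℝ) ^ 2 / 2⌋₊) 0 φ₀ ∧
          star φ₀ ⬝ᵥ φ₀ = 1 ∧
          IsGroundStateInSector (hubbardTorus 2 L 1 U) (2 * ⌊(1 - δ) * (L : ℝ) ^ 2 / 2⌋₊ - 2) 0 χ₀ ∧
          star χ₀ ⬝ᵥ χ₀ = 1 ∧
          a * (L : ℝ) ^ 4 ≤ ‖star χ₀ ⬝ᵥ Matrix.mulVec (pairField dWaveFormFactor L) φ₀‖ ^ 2 := by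
  sorry

/-- **STUB `stub_irreducibleFloorDense`** (THE SPECTRAL RESIDUE replacing `JmCusp (ii)`, in its weakest,
WINDOW-RELATIVE form; reshaped cycle 4): for `δ ∈ (0, 1/2)` and a window of repulsive couplings `(U₁, U₂)` on which
the some-pair bridge holds (the hypothesis is the inner statement of `stub_someBridgeWindow`), for all large even `L`
the couplings of the window at which the `(N_L, 0)` ground floor of `hubbardTorus 2 L 1 U` is irreducible under the
SPACE GROUP of the torus (`U_γ U_v = fockD4 γ * fockTranslate v`) are DENSE in the window — no systematic (all-`U`)
accidental degeneracy of the floor inside a bridged window; symmetry-enforced multiplets are allowed. (By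
`irreducibilityLocallyConstant` this is decided, at each fixed `L`, by ONE coupling per crossing-free sub-interval.)
False at `L = 4` (hypercube hidden symmetry), hence the threshold `L₁`. Not claimed provable now. -/
theorem stub_irreducibleFloorDense :
    ∀ δ ∈ Set.Ioo (0:ℝ) (1 / 2), ∀ U₁ U₂ : ℝ, 0 < U₁ → U₁ < U₂ →
      (∀ U ∈ Set.Ioo U₁ U₂, ∃ a : ℝ, 0 < a ∧ ∃ L₀ : ℕ, ∀ (L : ℕ) [NeZero L], Even L → L₀ ≤ L →
        ∃ φ₀ χ₀ : Fock (Orb (FermionTorus 2 L)),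
          IsGroundStateInSector (hubbardTorus 2 L 1 U) (2 * ⌊(1 - δ) * (L : ℝ) ^ 2 / 2⌋₊) 0 φ₀ ∧
          star φ₀ ⬝ᵥ φ₀ = 1 ∧
          IsGroundStateInSector (hubbardTorus 2 L 1 U) (2 * ⌊(1 - δ) * (L : ℝ) ^ 2 / 2⌋₊ - 2) 0 χ₀ ∧
          star χ₀ ⬝ᵥ χ₀ = 1 ∧
          a * (L : ℝ) ^ 4 ≤ ‖star χ₀ ⬝ᵥ Matrix.mulVec (pairField dWaveFormFactor L) φ₀‖ ^ 2) →
      ∃ L₁ : ℕ, ∀ (L : ℕ) [NeZero L], Even L → L₁ ≤ L →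
        ∀ V₁ V₂ : ℝ, U₁ ≤ V₁ → V₁ < V₂ → V₂ ≤ U₂ → ∃ U ∈ Set.Ioo V₁ V₂,
        ∀ K' : Submodule ℂ (Fock (Orb (FermionTorus 2 L))),
          K' ≤ szSector (2 * ⌊(1 - δ) * (L : ℝ) ^ 2 / 2⌋₊) 0 ⊓
              Module.End.eigenspace (Matrix.toLin' (hubbardTorus 2 L 1 U))
                (((hubbardTorus 2 L 1 U).minEnergyOn (szSector (2 * ⌊(1 - δ) * (L : ℝ) ^ 2 / 2⌋₊) 0) : ℝ) : ℂ) →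
          (∀ (γ : DihedralGroup 4) (v : TorusSite 2 L), ∀ w ∈ K',
            ((fockD4 γ).val * (fockTranslate v).val) *ᵥ w ∈ K') →
          K' = ⊥ ∨ K' = szSector (2 * ⌊(1 - δ) * (L : ℝ) ^ 2 / 2⌋₊) 0 ⊓
              Module.End.eigenspace (Matrix.toLin' (hubbardTorus 2 L 1 U))
                (((hubbardTorus 2 L 1 U).minEnergyOn (szSector (2 * ⌊(1 - δ) * (L : ℝ) ^ 2 / 2⌋₊) 0) : ℝ) : ℂ) := by
  sorry

/-! ## The composition -/

/-- **Irreducibility at non-exceptional couplings of a window**, from density of irreducible couplings INSIDE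
that window only: if for all large even `L` every sub-window of `[U₁, U₂]` contains a coupling with a
space-group-irreducible `(N_L, 0)` floor, then for all large even `L` the floor is irreducible at every
non-exceptional coupling of `(U₁, U₂)` (`reducibleFloorPropagates`; skeleton copy of the LANDED
`irreducible_of_generic_of_denseOn`, p122189). [folklore] -/
theorem lineGlue_irreducible_of_generic_of_denseOn (δ : ℝ) (U₁ U₂ : ℝ)
    (hdense : ∃ L₁ : ℕ, ∀ (L : ℕ) [NeZero L], Even L → L₁ ≤ L →
      ∀ V₁ V₂ : ℝ, U₁ ≤ V₁ → V₁ < V₂ → V₂ ≤ U₂ → ∃ U ∈ Set.Ioo V₁ V₂,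
        ∀ K' : Submodule ℂ (Fock (Orb (FermionTorus 2 L))),
          K' ≤ szSector (2 * ⌊(1 - δ) * (L : ℝ) ^ 2 / 2⌋₊) 0 ⊓
              Module.End.eigenspace (Matrix.toLin' (hubbardTorus 2 L 1 U))
                (((hubbardTorus 2 L 1 U).minEnergyOn (szSector (2 * ⌊(1 - δ) * (L : ℝ) ^ 2 / 2⌋₊) 0) : ℝ) : ℂ) →
          (∀ (γ : DihedralGroup 4) (v : TorusSite 2 L), ∀ w ∈ K',
            ((fockD4 γ).val * (fockTranslate v).val) *ᵥ w ∈ K') →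
          K' = ⊥ ∨ K' = szSector (2 * ⌊(1 - δ) * (L : ℝ) ^ 2 / 2⌋₊) 0 ⊓
              Module.End.eigenspace (Matrix.toLin' (hubbardTorus 2 L 1 U))
                (((hubbardTorus 2 L 1 U).minEnergyOn (szSector (2 * ⌊(1 - δ) * (L : ℝ) ^ 2 / 2⌋₊) 0) : ℝ) : ℂ)) :
    ∃ L₁ : ℕ, ∀ (L : ℕ) [NeZero L], Even L → L₁ ≤ L → ∀ U ∈ Set.Ioo U₁ U₂,
      (∀ u' : ℝ, (hubbardTorus 2 L 1 u').charpoly.roots.toFinset.card ≤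
        (hubbardTorus 2 L 1 U).charpoly.roots.toFinset.card) →
      ∀ K' : Submodule ℂ (Fock (Orb (FermionTorus 2 L))),
        K' ≤ szSector (2 * ⌊(1 - δ) * (L : ℝ) ^ 2 / 2⌋₊) 0 ⊓
            Module.End.eigenspace (Matrix.toLin' (hubbardTorus 2 L 1 U))
              (((hubbardTorus 2 L 1 U).minEnergyOn (szSector (2 * ⌊(1 - δ) * (L : ℝ) ^ 2 / 2⌋₊) 0) : ℝ) : ℂ) →
        (∀ (γ : DihedralGroup 4) (v : TorusSite 2 L), ∀ w ∈ K',
          ((fockD4 γ).val * (fockTranslate v).val) *ᵥ w ∈ K') →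
        K' = ⊥ ∨ K' = szSector (2 * ⌊(1 - δ) * (L : ℝ) ^ 2 / 2⌋₊) 0 ⊓
            Module.End.eigenspace (Matrix.toLin' (hubbardTorus 2 L 1 U))
              (((hubbardTorus 2 L 1 U).minEnergyOn (szSector (2 * ⌊(1 - δ) * (L : ℝ) ^ 2 / 2⌋₊) 0) : ℝ) : ℂ) := by
  obtain ⟨L₁, hL₁⟩ := hdense
  refine ⟨L₁, fun L _ hE hL U hU hgen => ?_⟩
  by_contra hred
  obtain ⟨ε, hε, hbad⟩ := reducibleFloorPropagates L _ U hgen hred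
  obtain ⟨U', hU', hirr'⟩ := hL₁ L hE hL (max (U - ε / 2) U₁) (min (U + ε / 2) U₂) (le_max_right _ _)
    (max_lt (lt_min (by linarith) (by linarith [hU.2])) (lt_min (by linarith [hU.1]) (hU.1.trans hU.2)))
    (min_le_right _ _)
  have h1 : U - ε / 2 < U' := lt_of_le_of_lt (le_max_left _ _) hU'.1
  have h2 : U' < U + ε / 2 := lt_of_lt_of_le hU'.2 (min_le_left _ _)
  exact hbad U' ⟨by linarith, by linarith⟩ hirr'

/-- **`JmPairBridge_of`** — the line closes the crux modulo its two residue stubs (everything else is landed); this is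
the proof of the LANDED `jmPairBridge_of_someBridgeWindow_of_denseOn` (`Theorems/JosephsonMirrorJmPairBridgeWindowResidue.lean`,
p122189) with its two hypotheses fed by `stub_someBridgeWindow` and `stub_irreducibleFloorDense`: the window residue gives
`(δ, U₁, U₂)`; a coupling `U⋆ ∈ (U₁, U₂)` non-exceptional for EVERY torus side is selected
(`exists_coupling_forall_card_roots_le_hubbardTorus`); at `U⋆` the some-pair bridge holds eventually with some `a > 0`,
the `(N_L, 0)` floor is eventually space-group irreducible (`lineGlue_irreducible_of_generic_of_denseOn` fed with the
density residue on the bridged window), and the landed Schur transfer (`everyFromSome_torus`,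
`exists_symmetryFamily_of_spaceGroup_irreducible`) bridges EVERY unit ground state. [folklore] -/
theorem JmPairBridge_of : JmPairBridge := by
  unfold JmPairBridge
  obtain ⟨δ, hδ, U₁, U₂, hU₁, hU₁₂, hwin⟩ := stub_someBridgeWindow
  obtain ⟨U, hU, hgenU⟩ := exists_coupling_forall_card_roots_le_hubbardTorus hU₁₂
  obtain ⟨a, ha, L₀, hsome⟩ := hwin U hU
  obtain ⟨L₁, hirr⟩ := lineGlue_irreducible_of_generic_of_denseOn δ U₁ U₂
    (stub_irreducibleFloorDense δ hδ U₁ U₂ hU₁ hU₁₂ hwin)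
  have hUpos : 0 < U := hU₁.trans hU.1
  refine ⟨U, hUpos, δ, hδ, a, ha, max L₀ L₁, fun L _ hE hL φ hφ hφ1 => ?_⟩
  obtain ⟨S, hS, hSirr⟩ := exists_symmetryFamily_of_spaceGroup_irreducible U
    (2 * ⌊(1 - δ) * (L : ℝ) ^ 2 / 2⌋₊) _ (hirr L hE (le_of_max_le_right hL) U hU (hgenU L))
  exact everyFromSome_torus L U _ _ S hS hSirr (hsome L hE (le_of_max_le_left hL)) φ hφ hφ1

end Summit.HubbardSuperconductivity.HubbardSuperconductivity.Theorems.JosephsonMirror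

end
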